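import Mathlib
import Summits.NavierStokesRegularity.NavierStokesRegularity.Theorems.SlicedKelvinPlanarFluxAPrioriDecayBootstrap
import Summits.NavierStokesRegularity.NavierStokesRegularity.Theorems.SlicedKelvinPlanarFluxAPrioriDecayOseenRepresentation
import Summits.NavierStokesRegularity.NavierStokesRegularity.Theorems.SlicedKelvinPlanarFluxAPrioriDecayLineDeriv
import Summits.NavierStokesRegularity.NavierStokesRegularity.Theorems.SlicedKelvinPlanarFluxAPrioriDecaySlabBounds

/-!
# Crux `SlicedKelvin.PlanarFluxAPriori` (stmt-NavierStokesRegularity-15600), line `registered`,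
# stub `stub_decayPersistence` — cubic decay of the nested directional derivatives, level by level

Support file (theorems only) for the decay-persistence stub: for `ν > 0`, a classical solution
`(u, p)` of the unforced Navier–Stokes system on `ℝ³ × [0, T)` which is Leray–Hopf from its rapidly
decaying datum, and `T₁ < T`, the fields `u`, `∂_v u`, `∂_w∂_v u`, `∂_z∂_w∂_v u` (unit directions)
carry the cubic weight `(1 + |x|)³` uniformly on `[0, T₁] × ℝ³` (`decay_levels`; Brandolese 2004;
Kukavica–Torres 2006).

## Proof

Everything is a theorem of the tree; no named fact is assumed.

1. (*bounds on closed slabs*) By Tao 2013, Cor. 11.1 and the Sobolev imbedding, `u` and all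
   nested unit directional derivatives of order `≤ 3` are bounded with their derivatives on
   `[0, T₂] × ℝ³`, `T₂ = (T₁ + T)/2`, and decay cubically at `t = 0` (`decay_field_package`).
2. (*Oseen representation*) Being bounded with square-integrable slices, `u` satisfies the mild
   equation `u(τ) = e^{ντΔ}u(0) - B^ν_0(u,u)(τ)` on `(0, T₂)`
   (`decay_oseen_representation_from_zero`), and differentiating along lines
   (`decay_fderiv_of_representation`) each `∂_{v_m}⋯∂_{v_1}u` is represented by `e^{ντΔ}` of its
   datum and `2^m` Duhamel terms `B^ν_0(a, b)` indexed by iterated sums `Unit ⊕ ⋯`, whose entries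
   are nested derivatives of order `≤ m`, each pair containing the field itself or a field of
   order `≤ 1`.
3. (*weighted bootstrap*) The abstract Gronwall argument on truncated cubic weights
   (`decay_weighted_bootstrap`) propagates the cubic decay level by level, `m = 0, 1, 2, 3`, with
   constants uniform in the unit directions.

## References

* L. Brandolese, Math. Ann. 329 (2004) = arXiv:math/0403136.
* I. Kukavica, J. J. Torres, Nonlinearity 19 (2006).
* G. Koch, N. Nadirashvili, G. Seregin, V. Šverák, Acta Math. 203 (2009), §3–§4.
* T. Tao, Anal. PDE 6 (2013), Cor. 11.1.
-/

noncomputable section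

-- the summit and its single sub-problem share the name (CONVENTIONS §1), as in every Theorems file
set_option linter.dupNamespace false

namespace Summit.NavierStokesRegularity.NavierStokesRegularity.Theorems.SlicedKelvinPlanarFluxAPriori

open MeasureTheory Set Filter Topology Metric Real Function
open scoped ENNReal NNReal ContDiff
open Literature.Analysis.FluidPDE Literature.Analysis.UnboundedOperators

/-- Re-indexing of the Leibniz-expanded Duhamel terms over `ι ⊕ ι` (first-order form of
`decay_sum_elim_reindex` for the Oseen–Duhamel operator). -/
theorem decay_duhamel_reindex {ι : Type} [Fintype ι] (ν τ : ℝ) (x : EuclideanSpace ℝ (Fin 3))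
    (a b a' b' : ι → ℝ → EuclideanSpace ℝ (Fin 3) → EuclideanSpace ℝ (Fin 3)) :
    ∑ j : ι ⊕ ι, oseenDuhamel ν 0 (Sum.elim a' a j) (Sum.elim b b' j) τ x =
      ∑ i, (oseenDuhamel ν 0 (a' i) (b i) τ x + oseenDuhamel ν 0 (a i) (b' i) τ x) :=
  decay_sum_elim_reindex (fun f g => oseenDuhamel ν 0 f g τ x) a b a' b'

/-- **Cubic decay of the nested unit directional derivatives of order `≤ 3`.** For `ν > 0`, a
classical solution of the unforced system on `ℝ³ × [0, T)`, Leray–Hopf from its rapidly decaying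
datum, and `T₁ ∈ (0, T)`, there is `C` with
`(1 + |x|)³ (|u| + |∂_v u| + |∂_w∂_v u| + |∂_z∂_w∂_v u|)(τ, x) ≤ C` term by term on
`[0, T₁] × ℝ³` for all unit directions `v, w, z` (steps 1–3 of the module docstring). -/
theorem decay_levels :
    ∀ {ν T : ℝ} (hν : 0 < ν) {u : ℝ → EuclideanSpace ℝ (Fin 3) → EuclideanSpace ℝ (Fin 3)}
    {p : ℝ → EuclideanSpace ℝ (Fin 3) → ℝ}
    (hcl : Literature.Analysis.FluidPDE.IsClassicalNSSolutionOn (Set.Ico 0 T) ν 0 u p)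
    (hLH : Literature.Analysis.FluidPDE.IsLerayHopfOn T ν 0 (u 0) u)
    (hdec : Literature.Analysis.FluidPDE.HasRapidSpatialDecay (u 0)) {T₁ : ℝ} (hT₁ : T₁ ∈ Set.Ioo 0 T),
    ∃ C : ℝ, ∀ τ ∈ Set.Icc 0 T₁, ∀ x : EuclideanSpace ℝ (Fin 3),
      (1 + ‖x‖) ^ 3 * ‖u τ x‖ ≤ C ∧
      (∀ v : EuclideanSpace ℝ (Fin 3), ‖v‖ ≤ 1 → (1 + ‖x‖) ^ 3 * ‖fderiv ℝ (u τ) x v‖ ≤ C) ∧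
      (∀ v w : EuclideanSpace ℝ (Fin 3), ‖v‖ ≤ 1 → ‖w‖ ≤ 1 →
        (1 + ‖x‖) ^ 3 * ‖fderiv ℝ (fun y => fderiv ℝ (u τ) y v) x w‖ ≤ C) ∧
      (∀ v w z : EuclideanSpace ℝ (Fin 3), ‖v‖ ≤ 1 → ‖w‖ ≤ 1 → ‖z‖ ≤ 1 →
        (1 + ‖x‖) ^ 3 * ‖fderiv ℝ (fun y' => fderiv ℝ (fun y => fderiv ℝ (u τ) y v) y' w) x z‖ ≤ C) := by
  intro ν T hν u p hcl hLH hdec T₁ hT₁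
  -- the slabs `T₁ < T₂ < T`
  set T₂ : ℝ := (T₁ + T) / 2 with hT₂
  have hT₂' : T₂ ∈ Ioo 0 T := ⟨by rw [hT₂]; linarith [hT₁.1, hT₁.2], by rw [hT₂]; linarith [hT₁.2]⟩
  have hT₁T₂ : T₁ < T₂ := by rw [hT₂]; linarith [hT₁.2]
  -- Step 1: bounds on the closed slab `[0, T₂]`
  obtain ⟨L, D, hL0, hD0, hpack⟩ := decay_field_package hν hcl hLH hdec hT₂'
  have hu : IsSmoothSpaceTimeOn (Ico 0 T) u := hcl.smooth_velocity
  -- the domination property of order `m` and its propagation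
  have hP0 : ∀ τ ∈ Ico 0 T, ∀ (j : ℕ) (y : EuclideanSpace ℝ (Fin 3)),
      ‖iteratedFDeriv ℝ j (u τ) y‖ ≤ ‖iteratedFDeriv ℝ (j + 0) (u τ) y‖ := fun τ _ j y => by
    rw [add_zero]
  -- notation-free nested derivatives: `d v F = ∂_v F`
  -- level-1/2/3 fields and their domination
  have hP1 : ∀ {v : EuclideanSpace ℝ (Fin 3)}, ‖v‖ ≤ 1 →
      IsSmoothSpaceTimeOn (Ico 0 T) (fun τ y => fderiv ℝ (u τ) y v) ∧
        ∀ τ ∈ Ico 0 T, ∀ (j : ℕ) (y : EuclideanSpace ℝ (Fin 3)),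
          ‖iteratedFDeriv ℝ j (fun z => fderiv ℝ (u τ) z v) y‖ ≤ ‖iteratedFDeriv ℝ (j + (0 + 1)) (u τ) y‖ :=
    fun {v} hv => decay_P_dirDeriv hu hP0 hv
  have hP2 : ∀ {v w : EuclideanSpace ℝ (Fin 3)}, ‖v‖ ≤ 1 → ‖w‖ ≤ 1 →
      IsSmoothSpaceTimeOn (Ico 0 T) (fun τ y => fderiv ℝ (fun z => fderiv ℝ (u τ) z v) y w) ∧
        ∀ τ ∈ Ico 0 T, ∀ (j : ℕ) (y : EuclideanSpace ℝ (Fin 3)),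
          ‖iteratedFDeriv ℝ j (fun y' => fderiv ℝ (fun z => fderiv ℝ (u τ) z v) y' w) y‖ ≤
            ‖iteratedFDeriv ℝ (j + (0 + 1 + 1)) (u τ) y‖ :=
    fun {v w} hv hw => decay_P_dirDeriv (hP1 hv).1 (hP1 hv).2 hw
  have hP3 : ∀ {v w z : EuclideanSpace ℝ (Fin 3)}, ‖v‖ ≤ 1 → ‖w‖ ≤ 1 → ‖z‖ ≤ 1 →
      IsSmoothSpaceTimeOn (Ico 0 T)
        (fun τ y => fderiv ℝ (fun y' => fderiv ℝ (fun z' => fderiv ℝ (u τ) z' v) y' w) y z) ∧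
        ∀ τ ∈ Ico 0 T, ∀ (j : ℕ) (y : EuclideanSpace ℝ (Fin 3)),
          ‖iteratedFDeriv ℝ j (fun y'' => fderiv ℝ (fun y' => fderiv ℝ (fun z' => fderiv ℝ (u τ) z' v) y' w) y'' z) y‖ ≤
            ‖iteratedFDeriv ℝ (j + (0 + 1 + 1 + 1)) (u τ) y‖ :=
    fun {v w z} hv hw hz => decay_P_dirDeriv (hP2 hv hw).1 (hP2 hv hw).2 hz
  -- bounds of the four kinds of fields on `[0, T₂]` and decay at `0`
  have hB0 := hpack u 0 (by norm_num) hu hP0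
  have hB1 : ∀ {v : EuclideanSpace ℝ (Fin 3)}, ‖v‖ ≤ 1 →
      (∀ τ ∈ Icc 0 T₂, ∀ y, ‖fderiv ℝ (u τ) y v‖ ≤ L ∧ ‖fderiv ℝ (fun z => fderiv ℝ (u τ) z v) y‖ ≤ L) ∧
        ∀ y, (1 + ‖y‖) ^ 3 * ‖fderiv ℝ (u 0) y v‖ ≤ D :=
    fun {v} hv => hpack _ 1 (by norm_num) (hP1 hv).1 (hP1 hv).2
  have hB2 : ∀ {v w : EuclideanSpace ℝ (Fin 3)}, ‖v‖ ≤ 1 → ‖w‖ ≤ 1 →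
      (∀ τ ∈ Icc 0 T₂, ∀ y, ‖fderiv ℝ (fun z => fderiv ℝ (u τ) z v) y w‖ ≤ L ∧
        ‖fderiv ℝ (fun y' => fderiv ℝ (fun z => fderiv ℝ (u τ) z v) y' w) y‖ ≤ L) ∧
        ∀ y, (1 + ‖y‖) ^ 3 * ‖fderiv ℝ (fun z => fderiv ℝ (u 0) z v) y w‖ ≤ D :=
    fun {v w} hv hw => hpack _ 2 (by norm_num) (hP2 hv hw).1 (hP2 hv hw).2
  have hB3 : ∀ {v w z : EuclideanSpace ℝ (Fin 3)}, ‖v‖ ≤ 1 → ‖w‖ ≤ 1 → ‖z‖ ≤ 1 →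
      (∀ τ ∈ Icc 0 T₂, ∀ y, ‖fderiv ℝ (fun y' => fderiv ℝ (fun z' => fderiv ℝ (u τ) z' v) y' w) y z‖ ≤ L ∧
        ‖fderiv ℝ (fun y'' => fderiv ℝ (fun y' => fderiv ℝ (fun z' => fderiv ℝ (u τ) z' v) y' w) y'' z) y‖ ≤ L) ∧
        ∀ y, (1 + ‖y‖) ^ 3 * ‖fderiv ℝ (fun y' => fderiv ℝ (fun z' => fderiv ℝ (u 0) z' v) y' w) y z‖ ≤ D :=
    fun {v w z} hv hw hz => hpack _ 3 le_rfl (hP3 hv hw hz).1 (hP3 hv hw hz).2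
  have hIcc : ∀ {τ : ℝ}, τ ∈ Icc 0 T₁ → τ ∈ Icc 0 T₂ := fun {τ} hτ => ⟨hτ.1, hτ.2.trans hT₁T₂.le⟩
  have hIcc' : ∀ {σ τ : ℝ}, σ ∈ Icc 0 τ → τ ≤ T₁ → σ ∈ Icc 0 T₂ := fun {σ τ} hσ hτ =>
    ⟨hσ.1, (hσ.2.trans hτ).trans hT₁T₂.le⟩
  -- Step 2: the Oseen representation of `u` from `0` on `(0, T₂)`
  have hK2 : ∀ τ ∈ Icc 0 T₂, eLpNorm (u τ) 2 volume ≤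
      (ENNReal.ofReal (2 * VectorCalculus.kineticEnergy (u 0))) ^ (1 / 2 : ℝ) := fun τ hτ =>
    eLpNorm_two_le_rpow_of_lintegral_sq_le (hLH.lintegral_enorm_sq_le hν.le ⟨hτ.1, hτ.2.trans hT₂'.2.le⟩)
  have hKtop : (ENNReal.ofReal (2 * VectorCalculus.kineticEnergy (u 0))) ^ (1 / 2 : ℝ) ≠ ⊤ :=
    (ENNReal.rpow_lt_top_of_nonneg (by norm_num) ENNReal.ofReal_ne_top).ne
  have hrep0 : ∀ τ ∈ Ioc 0 T₁, ∀ z : EuclideanSpace ℝ (Fin 3), u τ z =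
      heatExtension (u 0) (ν * τ) z - ∑ _i : Unit, oseenDuhamel ν 0 u u τ z := by
    intro τ hτ z
    have h := decay_oseen_representation_from_zero hν hcl hT₂'.2 (fun σ hσ y => (hB0.1 σ hσ y).1) hKtop hK2
      ⟨hτ.1, hτ.2.trans_lt hT₁T₂⟩ z
    simpa using h
  -- representations of the nested derivatives: one Leibniz expansion per level
  have hrep1 : ∀ {v : EuclideanSpace ℝ (Fin 3)}, ‖v‖ ≤ 1 → ∀ τ ∈ Ioc 0 T₁, ∀ x : EuclideanSpace ℝ (Fin 3),
      fderiv ℝ (u τ) x v = heatExtension (fun y => fderiv ℝ (u 0) y v) (ν * τ) x -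
        ∑ j : Unit ⊕ Unit, oseenDuhamel ν 0
          (Sum.elim (fun _ : Unit => fun σ y => fderiv ℝ (u σ) y v) (fun _ : Unit => u) j)
          (Sum.elim (fun _ : Unit => u) (fun _ : Unit => fun σ y => fderiv ℝ (u σ) y v) j) τ x := by
    intro v hv τ hτ x
    have hτT : τ < T := (hτ.2.trans_lt hT₁T₂).trans hT₂'.2
    have h := decay_fderiv_of_representation hν (ι := Unit) (g := u) (a := fun _ => u) (b := fun _ => u)
      hτ.1 hτT hL0 ((hcl.contDiff_velocity ⟨le_rfl, hT₂'.1.trans hT₂'.2⟩).of_le (by norm_cast))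
      (fun y => (hB0.1 0 ⟨le_rfl, hT₂'.1.le⟩ y).1) (fun y => (hB0.1 0 ⟨le_rfl, hT₂'.1.le⟩ y).2)
      ((hcl.contDiff_velocity ⟨hτ.1.le, hτT⟩).differentiable (by simp))
      (fun _ => hu) (fun _ => hu) (fun _ σ hσ y => hB0.1 σ (hIcc' hσ hτ.2) y)
      (fun _ σ hσ y => hB0.1 σ (hIcc' hσ hτ.2) y) (hrep0 τ hτ) x v
    rw [h, decay_duhamel_reindex]
  have hrep2 : ∀ {v w : EuclideanSpace ℝ (Fin 3)}, ‖v‖ ≤ 1 → ‖w‖ ≤ 1 → ∀ τ ∈ Ioc 0 T₁,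
      ∀ x : EuclideanSpace ℝ (Fin 3),
      fderiv ℝ (fun y => fderiv ℝ (u τ) y v) x w =
        heatExtension (fun y => fderiv ℝ (fun y' => fderiv ℝ (u 0) y' v) y w) (ν * τ) x -
        ∑ j : (Unit ⊕ Unit) ⊕ (Unit ⊕ Unit), oseenDuhamel ν 0
          (Sum.elim
            (fun i => fun σ y => fderiv ℝ
              (Sum.elim (fun _ : Unit => fun σ y => fderiv ℝ (u σ) y v) (fun _ : Unit => u) i σ) y w)
            (Sum.elim (fun _ : Unit => fun σ y => fderiv ℝ (u σ) y v) (fun _ : Unit => u)) j)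
          (Sum.elim
            (Sum.elim (fun _ : Unit => u) (fun _ : Unit => fun σ y => fderiv ℝ (u σ) y v))
            (fun i => fun σ y => fderiv ℝ
              (Sum.elim (fun _ : Unit => u) (fun _ : Unit => fun σ y => fderiv ℝ (u σ) y v) i σ) y w) j)
          τ x := by
    intro v w hv hw τ hτ x
    have hτT : τ < T := (hτ.2.trans_lt hT₁T₂).trans hT₂'.2
    have h0 : (0 : ℝ) ∈ Ico 0 T := ⟨le_rfl, hT₂'.1.trans hT₂'.2⟩
    have h := decay_fderiv_of_representation hν (ι := Unit ⊕ Unit) (g := fun σ y => fderiv ℝ (u σ) y v)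
      (a := Sum.elim (fun _ : Unit => fun σ y => fderiv ℝ (u σ) y v) (fun _ : Unit => u))
      (b := Sum.elim (fun _ : Unit => u) (fun _ : Unit => fun σ y => fderiv ℝ (u σ) y v))
      hτ.1 hτT hL0 (((hP1 hv).1.contDiff_slice h0).of_le (by norm_cast))
      (fun y => ((hB1 hv).1 0 ⟨le_rfl, hT₂'.1.le⟩ y).1) (fun y => ((hB1 hv).1 0 ⟨le_rfl, hT₂'.1.le⟩ y).2)
      (((hP1 hv).1.contDiff_slice ⟨hτ.1.le, hτT⟩).differentiable (by simp))
      (by rintro (_ | _) <;> simp only [Sum.elim_inl, Sum.elim_inr] <;> first | exact (hP1 hv).1 | exact hu)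
      (by rintro (_ | _) <;> simp only [Sum.elim_inl, Sum.elim_inr] <;> first | exact (hP1 hv).1 | exact hu)
      (by
        rintro (_ | _) σ hσ y <;> simp only [Sum.elim_inl, Sum.elim_inr]
        · exact (hB1 hv).1 σ (hIcc' hσ hτ.2) y
        · exact hB0.1 σ (hIcc' hσ hτ.2) y)
      (by
        rintro (_ | _) σ hσ y <;> simp only [Sum.elim_inl, Sum.elim_inr]
        · exact hB0.1 σ (hIcc' hσ hτ.2) y
        · exact (hB1 hv).1 σ (hIcc' hσ hτ.2) y)
      (hrep1 hv τ hτ) x w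
    rw [h, decay_duhamel_reindex]
  -- the level-3 representation
  have hrep3 : ∀ {v w z : EuclideanSpace ℝ (Fin 3)}, ‖v‖ ≤ 1 → ‖w‖ ≤ 1 → ‖z‖ ≤ 1 → ∀ τ ∈ Ioc 0 T₁,
      ∀ x : EuclideanSpace ℝ (Fin 3),
      fderiv ℝ (fun y' => fderiv ℝ (fun y => fderiv ℝ (u τ) y v) y' w) x z =
        heatExtension (fun y'' => fderiv ℝ (fun y' => fderiv ℝ (fun y => fderiv ℝ (u 0) y v) y' w) y'' z) (ν * τ) x -
        ∑ j : ((Unit ⊕ Unit) ⊕ (Unit ⊕ Unit)) ⊕ ((Unit ⊕ Unit) ⊕ (Unit ⊕ Unit)), oseenDuhamel ν 0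
          (Sum.elim
            (fun i => fun σ y => fderiv ℝ
              (Sum.elim
                (fun i => fun σ y => fderiv ℝ
                  (Sum.elim (fun _ : Unit => fun σ y => fderiv ℝ (u σ) y v) (fun _ : Unit => u) i σ) y w)
                (Sum.elim (fun _ : Unit => fun σ y => fderiv ℝ (u σ) y v) (fun _ : Unit => u)) i σ) y z)
            (Sum.elim
              (fun i => fun σ y => fderiv ℝ
                (Sum.elim (fun _ : Unit => fun σ y => fderiv ℝ (u σ) y v) (fun _ : Unit => u) i σ) y w)
              (Sum.elim (fun _ : Unit => fun σ y => fderiv ℝ (u σ) y v) (fun _ : Unit => u))) j)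
          (Sum.elim
            (Sum.elim
              (Sum.elim (fun _ : Unit => u) (fun _ : Unit => fun σ y => fderiv ℝ (u σ) y v))
              (fun i => fun σ y => fderiv ℝ
                (Sum.elim (fun _ : Unit => u) (fun _ : Unit => fun σ y => fderiv ℝ (u σ) y v) i σ) y w))
            (fun i => fun σ y => fderiv ℝ
              (Sum.elim
                (Sum.elim (fun _ : Unit => u) (fun _ : Unit => fun σ y => fderiv ℝ (u σ) y v))
                (fun i => fun σ y => fderiv ℝ
                  (Sum.elim (fun _ : Unit => u) (fun _ : Unit => fun σ y => fderiv ℝ (u σ) y v) i σ) y w) i σ) y z) j)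
          τ x := by
    intro v w z hv hw hz τ hτ x
    have hτT : τ < T := (hτ.2.trans_lt hT₁T₂).trans hT₂'.2
    have h0 : (0 : ℝ) ∈ Ico 0 T := ⟨le_rfl, hT₂'.1.trans hT₂'.2⟩
    have h := decay_fderiv_of_representation hν (ι := (Unit ⊕ Unit) ⊕ (Unit ⊕ Unit))
      (g := fun σ y' => fderiv ℝ (fun y => fderiv ℝ (u σ) y v) y' w)
      (a := Sum.elim
            (fun i => fun σ y => fderiv ℝ
              (Sum.elim (fun _ : Unit => fun σ y => fderiv ℝ (u σ) y v) (fun _ : Unit => u) i σ) y w)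
            (Sum.elim (fun _ : Unit => fun σ y => fderiv ℝ (u σ) y v) (fun _ : Unit => u)))
      (b := Sum.elim
            (Sum.elim (fun _ : Unit => u) (fun _ : Unit => fun σ y => fderiv ℝ (u σ) y v))
            (fun i => fun σ y => fderiv ℝ
              (Sum.elim (fun _ : Unit => u) (fun _ : Unit => fun σ y => fderiv ℝ (u σ) y v) i σ) y w))
      hτ.1 hτT hL0 (((hP2 hv hw).1.contDiff_slice h0).of_le (by norm_cast))
      (fun y => ((hB2 hv hw).1 0 ⟨le_rfl, hT₂'.1.le⟩ y).1) (fun y => ((hB2 hv hw).1 0 ⟨le_rfl, hT₂'.1.le⟩ y).2)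
      (((hP2 hv hw).1.contDiff_slice ⟨hτ.1.le, hτT⟩).differentiable (by simp))
      (by
        rintro ((_ | _) | (_ | _)) <;> simp only [Sum.elim_inl, Sum.elim_inr]
        · exact (hP2 hv hw).1
        · exact (hP1 hw).1
        · exact (hP1 hv).1
        · exact hu)
      (by
        rintro ((_ | _) | (_ | _)) <;> simp only [Sum.elim_inl, Sum.elim_inr]
        · exact hu
        · exact (hP1 hv).1
        · exact (hP1 hw).1
        · exact (hP2 hv hw).1)
      (by
        rintro ((_ | _) | (_ | _)) σ hσ y <;> simp only [Sum.elim_inl, Sum.elim_inr]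
        · exact (hB2 hv hw).1 σ (hIcc' hσ hτ.2) y
        · exact (hB1 hw).1 σ (hIcc' hσ hτ.2) y
        · exact (hB1 hv).1 σ (hIcc' hσ hτ.2) y
        · exact hB0.1 σ (hIcc' hσ hτ.2) y)
      (by
        rintro ((_ | _) | (_ | _)) σ hσ y <;> simp only [Sum.elim_inl, Sum.elim_inr]
        · exact hB0.1 σ (hIcc' hσ hτ.2) y
        · exact (hB1 hv).1 σ (hIcc' hσ hτ.2) y
        · exact (hB1 hw).1 σ (hIcc' hσ hτ.2) y
        · exact (hB2 hv hw).1 σ (hIcc' hσ hτ.2) y)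
      (hrep2 hv hw τ hτ) x z
    rw [h, decay_duhamel_reindex]
  -- Step 3: the weighted bootstrap, level by level
  have h0T : (0 : ℝ) ∈ Ico 0 T := ⟨le_rfl, hT₂'.1.trans hT₂'.2⟩
  -- level 0
  obtain ⟨C₀', hE0⟩ := decay_weighted_bootstrap ν T₁ L D 0 8 hν hT₁.1 hL0 hD0 le_rfl
  have hLev0 : ∀ τ ∈ Icc 0 T₁, ∀ x : EuclideanSpace ℝ (Fin 3), (1 + ‖x‖) ^ 3 * ‖u τ x‖ ≤ C₀' :=
    hE0 (ι := Unit) u (fun _ => u) (fun _ => u) (by simp) (hcl.contDiff_velocity h0T).continuous hB0.2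
      (fun τ hτ y => (hB0.1 τ (hIcc hτ) y).1)
      (fun _ => ⟨fun τ hτ y => ⟨(hB0.1 τ (hIcc hτ) y).1, (hB0.1 τ (hIcc hτ) y).1⟩, Or.inl rfl⟩) hrep0
  have hC₀'0 : 0 ≤ C₀' := le_trans (by positivity) (hLev0 0 ⟨le_rfl, hT₁.1.le⟩ 0)
  -- level 1
  obtain ⟨C₁', hE1⟩ := decay_weighted_bootstrap ν T₁ L D 0 8 hν hT₁.1 hL0 hD0 le_rfl
  have hLev1 : ∀ {v : EuclideanSpace ℝ (Fin 3)}, ‖v‖ ≤ 1 → ∀ τ ∈ Icc 0 T₁, ∀ x : EuclideanSpace ℝ (Fin 3),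
      (1 + ‖x‖) ^ 3 * ‖fderiv ℝ (u τ) x v‖ ≤ C₁' := by
    intro v hv
    exact hE1 (ι := Unit ⊕ Unit) (fun σ y => fderiv ℝ (u σ) y v)
      (Sum.elim (fun _ : Unit => fun σ y => fderiv ℝ (u σ) y v) (fun _ : Unit => u))
      (Sum.elim (fun _ : Unit => u) (fun _ : Unit => fun σ y => fderiv ℝ (u σ) y v))
      (by simp) ((hP1 hv).1.contDiff_slice h0T).continuous (hB1 hv).2
      (fun τ hτ y => ((hB1 hv).1 τ (hIcc hτ) y).1)
      (by
        rintro (_ | _) <;> simp only [Sum.elim_inl, Sum.elim_inr]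
        · exact ⟨fun τ hτ y => ⟨((hB1 hv).1 τ (hIcc hτ) y).1, (hB0.1 τ (hIcc hτ) y).1⟩, Or.inl trivial⟩
        · exact ⟨fun τ hτ y => ⟨(hB0.1 τ (hIcc hτ) y).1, ((hB1 hv).1 τ (hIcc hτ) y).1⟩, Or.inr (Or.inl trivial)⟩)
      (hrep1 hv)
  have hC₁'0 : 0 ≤ C₁' := le_trans (by positivity) (hLev1 (v := 0) (by simp) 0 ⟨le_rfl, hT₁.1.le⟩ 0)
  -- level 2
  obtain ⟨C₂', hE2⟩ := decay_weighted_bootstrap ν T₁ L D C₁' 8 hν hT₁.1 hL0 hD0 hC₁'0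
  have hLev2 : ∀ {v w : EuclideanSpace ℝ (Fin 3)}, ‖v‖ ≤ 1 → ‖w‖ ≤ 1 → ∀ τ ∈ Icc 0 T₁,
      ∀ x : EuclideanSpace ℝ (Fin 3),
      (1 + ‖x‖) ^ 3 * ‖fderiv ℝ (fun y => fderiv ℝ (u τ) y v) x w‖ ≤ C₂' := by
    intro v w hv hw
    exact hE2 (ι := (Unit ⊕ Unit) ⊕ (Unit ⊕ Unit)) (fun σ y' => fderiv ℝ (fun y => fderiv ℝ (u σ) y v) y' w)
      (Sum.elim
        (fun i => fun σ y => fderiv ℝ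
          (Sum.elim (fun _ : Unit => fun σ y => fderiv ℝ (u σ) y v) (fun _ : Unit => u) i σ) y w)
        (Sum.elim (fun _ : Unit => fun σ y => fderiv ℝ (u σ) y v) (fun _ : Unit => u)))
      (Sum.elim
        (Sum.elim (fun _ : Unit => u) (fun _ : Unit => fun σ y => fderiv ℝ (u σ) y v))
        (fun i => fun σ y => fderiv ℝ
          (Sum.elim (fun _ : Unit => u) (fun _ : Unit => fun σ y => fderiv ℝ (u σ) y v) i σ) y w))
      (by simp) ((hP2 hv hw).1.contDiff_slice h0T).continuous (hB2 hv hw).2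
      (fun τ hτ y => ((hB2 hv hw).1 τ (hIcc hτ) y).1)
      (by
        rintro ((_ | _) | (_ | _)) <;> simp only [Sum.elim_inl, Sum.elim_inr]
        · exact ⟨fun τ hτ y => ⟨((hB2 hv hw).1 τ (hIcc hτ) y).1, (hB0.1 τ (hIcc hτ) y).1⟩, Or.inl trivial⟩
        · exact ⟨fun τ hτ y => ⟨((hB1 hw).1 τ (hIcc hτ) y).1, ((hB1 hv).1 τ (hIcc hτ) y).1⟩,
            Or.inr (Or.inr (Or.inl (hLev1 hw)))⟩
        · exact ⟨fun τ hτ y => ⟨((hB1 hv).1 τ (hIcc hτ) y).1, ((hB1 hw).1 τ (hIcc hτ) y).1⟩,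
            Or.inr (Or.inr (Or.inl (hLev1 hv)))⟩
        · exact ⟨fun τ hτ y => ⟨(hB0.1 τ (hIcc hτ) y).1, ((hB2 hv hw).1 τ (hIcc hτ) y).1⟩, Or.inr (Or.inl trivial)⟩)
      (hrep2 hv hw)
  -- level 3
  obtain ⟨C₃', hE3⟩ := decay_weighted_bootstrap ν T₁ L D C₁' 8 hν hT₁.1 hL0 hD0 hC₁'0
  have hLev3 : ∀ {v w z : EuclideanSpace ℝ (Fin 3)}, ‖v‖ ≤ 1 → ‖w‖ ≤ 1 → ‖z‖ ≤ 1 → ∀ τ ∈ Icc 0 T₁,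
      ∀ x : EuclideanSpace ℝ (Fin 3),
      (1 + ‖x‖) ^ 3 * ‖fderiv ℝ (fun y' => fderiv ℝ (fun y => fderiv ℝ (u τ) y v) y' w) x z‖ ≤ C₃' := by
    intro v w z hv hw hz
    exact hE3 (ι := ((Unit ⊕ Unit) ⊕ (Unit ⊕ Unit)) ⊕ ((Unit ⊕ Unit) ⊕ (Unit ⊕ Unit)))
      (fun σ y'' => fderiv ℝ (fun y' => fderiv ℝ (fun y => fderiv ℝ (u σ) y v) y' w) y'' z)
      (Sum.elim
        (fun i => fun σ y => fderiv ℝ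
          (Sum.elim
            (fun i => fun σ y => fderiv ℝ
              (Sum.elim (fun _ : Unit => fun σ y => fderiv ℝ (u σ) y v) (fun _ : Unit => u) i σ) y w)
            (Sum.elim (fun _ : Unit => fun σ y => fderiv ℝ (u σ) y v) (fun _ : Unit => u)) i σ) y z)
        (Sum.elim
          (fun i => fun σ y => fderiv ℝ
            (Sum.elim (fun _ : Unit => fun σ y => fderiv ℝ (u σ) y v) (fun _ : Unit => u) i σ) y w)
          (Sum.elim (fun _ : Unit => fun σ y => fderiv ℝ (u σ) y v) (fun _ : Unit => u))))
      (Sum.elim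
        (Sum.elim
          (Sum.elim (fun _ : Unit => u) (fun _ : Unit => fun σ y => fderiv ℝ (u σ) y v))
          (fun i => fun σ y => fderiv ℝ
            (Sum.elim (fun _ : Unit => u) (fun _ : Unit => fun σ y => fderiv ℝ (u σ) y v) i σ) y w))
        (fun i => fun σ y => fderiv ℝ
          (Sum.elim
            (Sum.elim (fun _ : Unit => u) (fun _ : Unit => fun σ y => fderiv ℝ (u σ) y v))
            (fun i => fun σ y => fderiv ℝ
              (Sum.elim (fun _ : Unit => u) (fun _ : Unit => fun σ y => fderiv ℝ (u σ) y v) i σ) y w) i σ) y z))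
      (by simp) ((hP3 hv hw hz).1.contDiff_slice h0T).continuous (hB3 hv hw hz).2
      (fun τ hτ y => ((hB3 hv hw hz).1 τ (hIcc hτ) y).1)
      (by
        rintro (((_ | _) | (_ | _)) | ((_ | _) | (_ | _))) <;> simp only [Sum.elim_inl, Sum.elim_inr]
        · exact ⟨fun τ hτ y => ⟨((hB3 hv hw hz).1 τ (hIcc hτ) y).1, (hB0.1 τ (hIcc hτ) y).1⟩, Or.inl trivial⟩
        · exact ⟨fun τ hτ y => ⟨((hB2 hw hz).1 τ (hIcc hτ) y).1, ((hB1 hv).1 τ (hIcc hτ) y).1⟩,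
            Or.inr (Or.inr (Or.inr (hLev1 hv)))⟩
        · exact ⟨fun τ hτ y => ⟨((hB2 hv hz).1 τ (hIcc hτ) y).1, ((hB1 hw).1 τ (hIcc hτ) y).1⟩,
            Or.inr (Or.inr (Or.inr (hLev1 hw)))⟩
        · exact ⟨fun τ hτ y => ⟨((hB1 hz).1 τ (hIcc hτ) y).1, ((hB2 hv hw).1 τ (hIcc hτ) y).1⟩,
            Or.inr (Or.inr (Or.inl (hLev1 hz)))⟩
        · exact ⟨fun τ hτ y => ⟨((hB2 hv hw).1 τ (hIcc hτ) y).1, ((hB1 hz).1 τ (hIcc hτ) y).1⟩,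
            Or.inr (Or.inr (Or.inr (hLev1 hz)))⟩
        · exact ⟨fun τ hτ y => ⟨((hB1 hw).1 τ (hIcc hτ) y).1, ((hB2 hv hz).1 τ (hIcc hτ) y).1⟩,
            Or.inr (Or.inr (Or.inl (hLev1 hw)))⟩
        · exact ⟨fun τ hτ y => ⟨((hB1 hv).1 τ (hIcc hτ) y).1, ((hB2 hw hz).1 τ (hIcc hτ) y).1⟩,
            Or.inr (Or.inr (Or.inl (hLev1 hv)))⟩
        · exact ⟨fun τ hτ y => ⟨(hB0.1 τ (hIcc hτ) y).1, ((hB3 hv hw hz).1 τ (hIcc hτ) y).1⟩, Or.inr (Or.inl trivial)⟩)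
      (hrep3 hv hw hz)
  -- the uniform constant
  refine ⟨max (max C₀' C₁') (max C₂' C₃'), fun τ hτ x => ⟨?_, fun v hv => ?_, fun v w hv hw => ?_,
    fun v w z hv hw hz => ?_⟩⟩
  · exact (hLev0 τ hτ x).trans ((le_max_left _ _).trans (le_max_left _ _))
  · exact (hLev1 hv τ hτ x).trans ((le_max_right _ _).trans (le_max_left _ _))
  · exact (hLev2 hv hw τ hτ x).trans ((le_max_left _ _).trans (le_max_right _ _))
  · exact (hLev3 hv hw hz τ hτ x).trans ((le_max_right _ _).trans (le_max_right _ _))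

end Summit.NavierStokesRegularity.NavierStokesRegularity.Theorems.SlicedKelvinPlanarFluxAPriori

end
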